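import Summits.CriticalPhenomena.PercolationContinuityZ3.Theorems.PercNearOneGluingNoHeavyLowerTailStarSetClassOdds
import Summits.CriticalPhenomena.PercolationContinuityZ3.Theorems.PercNearOneGluingNoHeavyLowerTailStarSetClassWordsMulti
import HarnessLib

/-!
# `NoHeavyLowerTail` (stmt-CriticalPhenomena-4575) — class-words weigh at least `C0 · Π_X t_X`

Support file (prover `prim-gen-swap` gen 11; `--supports stmt-CriticalPhenomena-4575`).  No definitions, no named facts, no sorries.

B1d of the Lean blueprint (U1-PROOF.md §11): combining the exact factorisation `StarSet.sum_patterns_classWord_eq` with the one-star bound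
`(1−θ_i)(c_i(0)+c_i(k_i)) ≥ c_i(0)` (`StarSet.coeffZero_le_oneSubTheta_mul_sum(')`) gives, in division-free form,
`(Π_{X∈T} e_X) · mass(T,k) ≥ (Π_{X∈T} Θ_X) · Π_i c_i(0)`, i.e. `mass(T,k) ≥ C0·Π_{X∈T} t_X` (L1.1 of U1-PROOF.md: "a class-word weighs at least the
product of the class weights `t_X = Θ_X/e_X`").

* `StarSet.prod_coeffZero_split_classes` — `Π_i c_i(0) = Π_{cls i ∉ T} c_i(0) · Π_{X∈T} Π_{cls i = X} c_i(0)`;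
* `StarSet.classWord_mass_ge` — the bound.
-/

namespace Summit.CriticalPhenomena.PercolationContinuityZ3.Theorems

open Finset
open scoped BigOperators

namespace StarSet

variable {m : ℕ} {κ : Type*} [DecidableEq κ]

/-- Splitting `Π_i f i` along the classes of `T`. -/
theorem prod_coeffZero_split_classes (cls : Fin m → κ) (T : Finset κ) (f : Fin m → ℝ) :
    ∏ i, f i = (∏ i ∈ univ.filter (fun i => cls i ∉ T), f i) * ∏ X ∈ T, ∏ i ∈ univ.filter (fun i => cls i = X), f i := by
  classical
  rw [← prod_filter_mul_prod_filter_not univ (fun i => cls i ∉ T)]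
  congr 1
  have hmaps : ∀ i ∈ univ.filter (fun i => ¬ cls i ∉ T), cls i ∈ T := fun i hi => by simpa using (mem_filter.1 hi).2
  rw [← prod_fiberwise_of_maps_to hmaps]
  refine prod_congr rfl fun X hX => prod_congr ?_ fun _ _ => rfl
  ext i
  simp only [mem_filter, mem_univ, true_and, not_not]
  exact ⟨fun h => h.2, fun h => ⟨h ▸ hX, h⟩⟩

/-- **A class-word weighs at least `C0·Π_X t_X`** (division-free form).  See the file header. [U1-PROOF.md L1.1] -/
theorem classWord_mass_ge (c : Fin m → Fin 3 → ℝ) (θ : Fin m → ℝ) (cls : Fin m → κ) (T : Finset κ) (k : Fin m → Fin 3)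
    (hk : ∀ i, k i ≠ 0) (hθ0 : ∀ i, 0 ≤ θ i) (hθ1 : ∀ i, θ i ≤ 1) (hc0 : ∀ i, 0 ≤ c i 0)
    (hstar : ∀ i, cls i ∈ T → c i 0 ≤ (1 - θ i) * (c i 0 + c i (k i))) :
    (∏ X ∈ T, (1 - ∏ i ∈ univ.filter (fun i => cls i = X), (1 - θ i))) * ∏ i, c i 0 ≤
      (∏ X ∈ T, ∏ i ∈ univ.filter (fun i => cls i = X), (1 - θ i)) *
        ∑ e ∈ (univ : Finset (Fin m → Fin 3)).filter (fun e =>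
          (∀ i, cls i ∉ T → e i = 0) ∧ (∀ i, cls i ∈ T → (e i = 0 ∨ e i = k i)) ∧ (∀ X ∈ T, ∃ i, cls i = X ∧ e i ≠ 0)),
          ∏ i, c i (e i) := by
  classical
  rw [sum_patterns_classWord_eq cls k hk T c, prod_coeffZero_split_classes cls T (fun i => c i 0)]
  have hC : 0 ≤ ∏ i ∈ univ.filter (fun i => cls i ∉ T), c i 0 := prod_nonneg fun i _ => hc0 i
  -- class by class: `(1 − e_X)·Z_X ≤ e_X·(M_X − Z_X)`
  have hcls : ∀ X ∈ T,
      (1 - ∏ i ∈ univ.filter (fun i => cls i = X), (1 - θ i)) * ∏ i ∈ univ.filter (fun i => cls i = X), c i 0 ≤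
        (∏ i ∈ univ.filter (fun i => cls i = X), (1 - θ i)) *
          ((∏ i ∈ univ.filter (fun i => cls i = X), (c i 0 + c i (k i))) - ∏ i ∈ univ.filter (fun i => cls i = X), c i 0) :=
    fun X hX => classWeight_mul_prod_coeffZero_le _ θ (fun i => c i 0) (fun i => c i (k i))
      (fun i _ => hc0 i) (fun i hi => hstar i ((mem_filter.1 hi).2 ▸ hX))
  have hnn : ∀ X ∈ T, 0 ≤ (1 - ∏ i ∈ univ.filter (fun i => cls i = X), (1 - θ i)) * ∏ i ∈ univ.filter (fun i => cls i = X), c i 0 := by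
    intro X _
    refine mul_nonneg ?_ (prod_nonneg fun i _ => hc0 i)
    have : ∏ i ∈ univ.filter (fun i => cls i = X), (1 - θ i) ≤ 1 :=
      prod_le_one (fun i _ => by linarith [hθ1 i]) (fun i _ => by linarith [hθ0 i])
    linarith
  have hprod := prod_le_prod hnn hcls
  rw [prod_mul_distrib, prod_mul_distrib] at hprod
  calc (∏ X ∈ T, (1 - ∏ i ∈ univ.filter (fun i => cls i = X), (1 - θ i))) *
        ((∏ i ∈ univ.filter (fun i => cls i ∉ T), c i 0) * ∏ X ∈ T, ∏ i ∈ univ.filter (fun i => cls i = X), c i 0)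
      = (∏ i ∈ univ.filter (fun i => cls i ∉ T), c i 0) *
          ((∏ X ∈ T, (1 - ∏ i ∈ univ.filter (fun i => cls i = X), (1 - θ i))) *
            ∏ X ∈ T, ∏ i ∈ univ.filter (fun i => cls i = X), c i 0) := by ring
    _ ≤ (∏ i ∈ univ.filter (fun i => cls i ∉ T), c i 0) *
          ((∏ X ∈ T, ∏ i ∈ univ.filter (fun i => cls i = X), (1 - θ i)) *
            ∏ X ∈ T, ((∏ i ∈ univ.filter (fun i => cls i = X), (c i 0 + c i (k i))) -
              ∏ i ∈ univ.filter (fun i => cls i = X), c i 0)) := mul_le_mul_of_nonneg_left hprod hC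
    _ = _ := by ring
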